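import Literature.AlgebraicGeometry.Shioda1982.ExceptionalQuadruplesComplete
import HarnessLib

/-!
# Shioda's condition `(P⁴ₘ)` by kernel exhaustion, and `(P⁴₃₉)`

HONEST FRAMING: explicit algebraic cycles for specific Hodge classes on Fermat/Delsarte varieties;
residual open instances listed; no claim on general Hodge.

Topic path `Summits/HodgeConjecture/FermatCycles/` of cell `pub-hfermat` (new work, not literature: the results certified here are
the cell's computer determination `P4-TABLE.md` of Shioda's condition `(P⁴ₘ)`, which print does not contain for these `m`).

WHAT IS PROVED. The tree's `FermatCharacter.ShiodaConditionUpTo m 4` is Shioda's condition `(P⁴ₘ)` in the Proc. Japan Acad. form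
(every Hodge `6`-multiset over `ℤ/m` — element of `Mₘ` of length `3` — is decomposable, quasi-decomposable or semi-decomposable;
file `Literature/AlgebraicGeometry/HodgeTheory/FermatShiodaCondition.lean`, where `(Pₘ)` is proved for `m` prime, `4`, `6`, …, and
`(P⁴₂₅)`, `(P⁴₃₅)` are refuted). By Shioda's Theorem 1 [Shioda1979PJA, §2] `(P⁴ₘ)` implies the Hodge conjecture for the Fermat
fourfold `X⁴ₘ`; in the tree this is the spine `IsShiodaClosed.of_shiodaConditionUpTo` (every Shioda-closed family of cycle characters
contains all Hodge characters of `X⁴ₘ`). Here: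

* a kernel-evaluable SEARCH `checkB6 N a₀ len` over the sorted `6`-tuples of representatives `1 ≤ a ≤ b ≤ c ≤ d ≤ e ≤ f ≤ N-1` with
  `a + ⋯ + f = 3N` (the Hodge condition at `t = 1`), testing Shioda's equations (2) for every unit `t` (`hodgeB6`, in `ℕ`) and, on the
  Hodge survivors only, the decidable witnesses `HasPair` (a pair `{x, -x}` ⇒ decomposable), `semiB` (two zero-sum triples ⇒
  semi-decomposable), `quasiB` (a `3 + 3` split `P ⊔ P'` with `P ∗ (c)`, `P' ∗ (−c)` Hodge `4`-multisets, `c = −ΣP ≠ 0` ⇒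
  quasi-decomposable in da Silva's length-`1` form) on the actual multiset over `ℤ/N`;
* its SOUNDNESS `shiodaConditionUpTo_four_of_chunks`: chunks of first representatives covering `[1, N)` that all pass `checkB6` give
  `ShiodaConditionUpTo N 4` (sorting an arbitrary Hodge `6`-multiset, locating it in the search, and turning each Boolean witness into
  the tree's `IsDecomposable` / `IsSemiDecomposable` / `IsQuasiDecomposable` — the pair case is the tree's
  `IsHodgeMultiset.isDecomposable_of_pair`, the pair predicate the sibling file's `Shioda1982.HasPair`);
* **`shiodaConditionUpTo_thirtyNine_four : ShiodaConditionUpTo 39 4`** — `(P⁴₃₉)` holds (three chunks, `decide +kernel`; 83 036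
  candidate tuples, 1 582 Hodge `6`-multisets: 1 558 with a pair, 12 semi-decomposable, 12 quasi-decomposable — the cell's count, three
  implementations: `code/enum/p4table.py`, referee `impl-10`, and the prototype `code/lit/p39/proto.py` of this file).

Why `39`. `39 = 3·13` is the smallest degree for which no refereed theorem gives the Hodge conjecture for `X⁴ₘ` (`3 ∣ 39`: outside
da Silva's Prop. 3.1, `(m, 6) = 1`, `m ≤ 100`; outside Shioda's `m ≤ 20`/prime and Aoki's `p^e`, `2p^e`, `{2,3,5,7}`-smooth families)
while the cell's enumeration finds `(P⁴₃₉)` TRUE in the PJA form — and FALSE in the Math. Ann. 245 form without the semi-decomposable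
alternative (`Literature.AlgebraicGeometry.Shioda1979.not_conditionP_thirtynine_four`: the orbit of `(1,7,16,22,34,37)` is
semi-decomposable only). With this file, "HC(X⁴₃₉) follows from Shioda's Theorem 1 alone" rests on a kernel certificate for its
arithmetic half; the geometric half (Theorem 1 on the tree's real carriers) is the named fact of `FermatHodgeConjecture.lean`, as for
every `(Pₘ)` file of the tree.

PRINT STATUS (lit seat, 2026-08-20): no REFEREED theorem covers this degree; PUBLIC PRIORITY for HC(X⁴ₘ) at every odd `m ≤ 199` belongs to the
computer-assisted preprint [Jumagulov2026OddFermatFourfolds] (arXiv:2608.18134, July 2026; Thm 1.1, census Thm 1.5), whose Appendix C row at this level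
(`m = 39`: 140 Galois orbits = 137 decomposable + 1 quasi-decomposable + 2 "∗-split" = semi-decomposable, Shioda 1979 Math. Ann. 245 §4 Lemma 1) the cell reproduces by two independent enumerations (`code/lit/census/orbits.py`); this file is an INDEPENDENT
certificate checked by the Lean kernel, not a first claim.

References: [Shioda1979PJA] T. Shioda, Proc. Japan Acad. 55A (1979) 111–114, §1 (eqs. (2), (3), Definition (i)–(iii), `(Pⁿₘ)`), §2
Thm 1; [daSilva2021HodgeFermat] G. da Silva Jr., Experimental Results 2 (2021) e22, Def. 2.4, Prop. 3.1; [Shioda1979HodgeFermat]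
T. Shioda, Math. Ann. 245 (1979), Thm I (Hodge criterion), §3 (P). Cell files: `run/shared/lean/pub/pub-hfermat/pub-hfermat-enum/P4-TABLE.md`,
`data/shioda_P4_m3-100.json`.
[Jumagulov2026OddFermatFourfolds] R. Jumagulov, arXiv:2608.18134 (preprint, July 2026), Thm 1.1, Thm 1.5, Appendix C.
-/

namespace Summit.HodgeConjecture.FermatCycles.ShiodaConditionFourfold

open Multiset
open Literature.AlgebraicGeometry.HodgeTheory Literature.AlgebraicGeometry.HodgeTheory.FermatCharacter
open Literature.AlgebraicGeometry.Shioda1982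

/-! ### The witnesses, as decidable predicates on an explicit multiset over `ℤ/N` -/

/-- The Hodge condition in the `unitsList` form of `isHodgeMultiset_iff_unitsList`, as a Boolean on an explicit multiset over
`ℤ/N` (equivalent to `IsHodgeMultiset`, cheap for the kernel). [cite: Shioda1979PJA, §1 eqs. (2), (3)] -/
def hodgeUB (N : ℕ) (u : Multiset (ZMod N)) : Bool :=
  decide ((0 : ZMod N) ∉ u) && decide (u.sum = 0) &&
    (unitsList N).all fun t ↦ 2 * ((u.map ZMod.val).map fun x ↦ t * x % N).sum == N * card u

/-- `hodgeUB` decides the tree's `IsHodgeMultiset`. [cite: Shioda1979PJA, §1 eqs. (2), (3)] -/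
theorem isHodgeMultiset_of_hodgeUB {N : ℕ} [NeZero N] {u : Multiset (ZMod N)} (h : hodgeUB N u = true) :
    IsHodgeMultiset u := by
  rw [isHodgeMultiset_iff_unitsList u]
  unfold hodgeUB at h
  simp only [Bool.and_eq_true, decide_eq_true_eq, List.all_eq_true, beq_iff_eq] at h
  obtain ⟨⟨h0, hsum⟩, hall⟩ := h
  exact ⟨⟨fun a ha ha0 ↦ h0 (ha0 ▸ ha), hsum⟩, hall⟩

/-! Witness "contains a pair `{x, -x}`" is `Shioda1982.HasPair s` (`∃ a ∈ s, -a ∈ s.erase a`; decidable there). -/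

/-- Witness "splits into two zero-sum triples" (semi-decomposable), decided on an explicit multiset. [cite: Shioda1979PJA, §1 Definition (iii)] -/
instance decSemiWitness {N : ℕ} (s : Multiset (ZMod N)) :
    Decidable (∃ t ∈ s.powersetCard 3, t.sum = 0 ∧ (s - t).sum = 0) :=
  Multiset.decidableExistsMultiset

/-- `semiB`: the semi witness as a Boolean. [cite: Shioda1979PJA, §1 Definition (iii)] -/
def semiB {N : ℕ} (s : Multiset (ZMod N)) : Bool :=
  decide (∃ t ∈ s.powersetCard 3, t.sum = 0 ∧ (s - t).sum = 0)

/-- Witness "quasi-decomposable by a `3 + 3` split": a sub-triple `P` with `c := -ΣP ≠ 0` such that `P ∗ (c)` and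
`(s - P) ∗ (-c)` are Hodge `4`-multisets (then `s + {c, -c} = (P ∗ c) + ((s - P) ∗ (-c))`, da Silva's Def. 2.4), decided on an
explicit multiset. [cite: daSilva2021HodgeFermat, Def. 2.4] [cite: Shioda1979PJA, §1 Definition (ii)] -/
instance decQuasiWitness (N : ℕ) (s : Multiset (ZMod N)) :
    Decidable (∃ t ∈ s.powersetCard 3, t.sum ≠ 0 ∧ hodgeUB N ((-t.sum) ::ₘ t) = true ∧ hodgeUB N (t.sum ::ₘ (s - t)) = true) :=
  Multiset.decidableExistsMultiset

/-- `quasiB`: the quasi witness as a Boolean. [cite: daSilva2021HodgeFermat, Def. 2.4] -/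
def quasiB (N : ℕ) (s : Multiset (ZMod N)) : Bool :=
  decide (∃ t ∈ s.powersetCard 3, t.sum ≠ 0 ∧ hodgeUB N ((-t.sum) ::ₘ t) = true ∧ hodgeUB N (t.sum ::ₘ (s - t)) = true)

/-! ### Soundness of the three witnesses -/

/-- A pair witness decomposes a Hodge `6`-multiset (the tree's `isDecomposable_of_pair`). [cite: Shioda1979PJA, §1 Definition (i)] -/
theorem isDecomposable_of_hasPair {N : ℕ} [NeZero N] {s : Multiset (ZMod N)} (hs : IsHodgeMultiset s) (h6 : card s = 6)
    (h : HasPair s) : IsDecomposable s := by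
  obtain ⟨a, ha, hna⟩ := h
  refine hs.isDecomposable_of_pair (by omega) ha ?_
  split_ifs with hEq
  · rw [← hEq] at hna
    have h1 := Multiset.count_erase_self a s
    have hpos : 0 < count a (s.erase a) := Multiset.count_pos.mpr hna
    omega
  · exact Multiset.mem_of_mem_erase hna

/-- A semi witness makes a `6`-multiset semi-decomposable. [cite: Shioda1979PJA, §1 Definition (iii)] -/
theorem isSemiDecomposable_of_semiB {N : ℕ} {s : Multiset (ZMod N)} (h6 : card s = 6) (h : semiB s = true) :
    IsSemiDecomposable s := by
  obtain ⟨t, ht, h1, h2⟩ := of_decide_eq_true h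
  rw [mem_powersetCard] at ht
  refine ⟨t, s - t, ht.2, ?_, h1, h2, ?_⟩
  · rw [card_sub ht.1, h6, ht.2]
  · rw [add_comm, Multiset.sub_add_cancel ht.1]

/-- A quasi witness makes a Hodge `6`-multiset quasi-decomposable (da Silva's form, with `η = {c, -c}`, `ξ' = P ∗ c`, `ξ'' = P' ∗ (-c)`).
[cite: daSilva2021HodgeFermat, Def. 2.4] -/
theorem isQuasiDecomposable_of_quasiB {N : ℕ} [NeZero N] {s : Multiset (ZMod N)} (h6 : card s = 6)
    (h : quasiB N s = true) : IsQuasiDecomposable s := by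
  obtain ⟨t, ht, hne, hT', hU'⟩ := of_decide_eq_true h
  rw [mem_powersetCard] at ht
  have hT := isHodgeMultiset_of_hodgeUB hT'
  have hU := isHodgeMultiset_of_hodgeUB hU'
  have hcardU : card (t.sum ::ₘ (s - t)) = 4 := by rw [card_cons, card_sub ht.1, h6, ht.2]
  have hcardT : card ((-t.sum) ::ₘ t) = 4 := by rw [card_cons, ht.2]
  refine ⟨-t.sum, neg_ne_zero.mpr hne, (-t.sum) ::ₘ t, t.sum ::ₘ (s - t), cons_ne_zero, cons_ne_zero, hT, hU, ?_, ?_, ?_⟩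
  · intro hEq; have := congrArg card hEq; rw [hcardT, h6] at this; omega
  · intro hEq; have := congrArg card hEq; rw [hcardU, h6] at this; omega
  · rw [add_comm, pair_add_eq_cons_cons, neg_neg, cons_add, add_cons, Multiset.add_comm t (s - t),
      Multiset.sub_add_cancel ht.1]

/-! ### The search -/

/-- Shioda's equations (2) for a `6`-tuple of representatives summing to `3N`, for every unit `t ≠ 1` of `unitsList N` (in `ℕ`).
[cite: Shioda1979PJA, §1 eq. (2)] -/
def hodgeB6 (N a b c d e f : ℕ) : Bool :=
  (unitsList N).tail.all fun t ↦ t * a % N + t * b % N + t * c % N + t * d % N + t * e % N + t * f % N == 3 * N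

/-- The `6`-multiset `{a, b, c, d, e, −(a+b+c+d+e)}` over `ℤ/N` from representatives. [folklore] -/
def sext (N : ℕ) (a b c d e : ℕ) : Multiset (ZMod N) :=
  {(a : ZMod N), (b : ZMod N), (c : ZMod N), (d : ZMod N), (e : ZMod N),
    -((a : ZMod N) + (b : ZMod N) + (c : ZMod N) + (d : ZMod N) + (e : ZMod N))}

/-- The witness test on a Hodge survivor, decided on the actual multiset over `ℤ/N`. [cite: Shioda1979PJA, §1 Definition (i)-(iii)] -/
def restB6 (N : ℕ) (a b c d e : ℕ) : Bool :=
  decide (HasPair (sext N a b c d e)) || semiB (sext N a b c d e) || quasiB N (sext N a b c d e)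

/-- Lower end of the window for the fifth representative `e`: `e ≥ d` and `f = 3N − (a+b+c+d) − e ≤ N − 1`. [folklore] -/
def eLo (N s4 d : ℕ) : ℕ := max d (2 * N + 1 - s4)

/-- Upper end of the window for `e`: `e ≤ f`. [folklore] -/
def eHi (N s4 : ℕ) : ℕ := (3 * N - s4) / 2

/-- **The search at level `N` for first representatives `a ∈ [a₀, a₀ + len)`**: all sorted `6`-tuples with `Σ = 3N` either fail
the Hodge test or carry a witness. [cite: Shioda1979PJA, §1 condition (Pⁿₘ) with n = 4] -/
def checkB6 (N : ℕ) (a0 len : ℕ) : Bool :=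
  (List.range' a0 len).all fun a ↦ (List.range' a (N - a)).all fun b ↦ (List.range' b (N - b)).all fun c ↦
    (List.range' c (N - c)).all fun d ↦
      (List.range' (eLo N (a + b + c + d) d) (eHi N (a + b + c + d) + 1 - eLo N (a + b + c + d) d)).all fun e ↦
        (!(hodgeB6 N a b c d e (3 * N - (a + b + c + d + e))) || restB6 N a b c d e)

/-! ### Soundness of the search -/

/-- For a Hodge `6`-multiset the representatives sum to `3N` (Shioda's length `y = 3`). [cite: Shioda1979PJA, §1 eq. (2) with t = 1] -/
theorem sum_val_eq_of_isHodgeMultiset_six {N : ℕ} [NeZero N] {a b c d e f : ZMod N}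
    (h : IsHodgeMultiset ({a, b, c, d, e, f} : Multiset (ZMod N))) :
    a.val + b.val + c.val + d.val + e.val + f.val = 3 * N := by
  have := h.2 1
  simp [mNormSum, Multiset.insert_eq_cons] at this
  omega

/-- A Hodge `6`-multiset passes `hodgeB6` on its representatives. [cite: Shioda1979PJA, §1 eq. (2)] -/
theorem hodgeB6_of_isHodgeMultiset {N : ℕ} [NeZero N] {a b c d e f : ZMod N}
    (h : IsHodgeMultiset ({a, b, c, d, e, f} : Multiset (ZMod N))) :
    hodgeB6 N a.val b.val c.val d.val e.val f.val = true := by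
  rw [isHodgeMultiset_iff_unitsList] at h
  obtain ⟨-, h2⟩ := h
  unfold hodgeB6
  rw [List.all_eq_true]
  intro t ht
  have := h2 t (List.mem_of_mem_tail ht)
  simp [Multiset.insert_eq_cons] at this
  simp only [beq_iff_eq]
  omega

/-- `sext` of the representatives is the multiset itself. [folklore] -/
theorem sext_val {N : ℕ} [NeZero N] (a b c d e : ZMod N) :
    sext N a.val b.val c.val d.val e.val = {a, b, c, d, e, -(a + b + c + d + e)} := by
  simp [sext]

/-- Unpacking `checkB6 N a₀ len = true` at a visited tuple. [folklore] -/
theorem restB6_of_checkB6 {N a0 len : ℕ} (h : checkB6 N a0 len = true) {a b c d e : ℕ}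
    (ha0 : a0 ≤ a) (ha1 : a < a0 + len) (hab : a ≤ b) (hb : b < N) (hbc : b ≤ c) (hc : c < N) (hcd : c ≤ d) (hd : d < N)
    (hde : d ≤ e) (hef : e ≤ 3 * N - (a + b + c + d + e)) (hf : 3 * N - (a + b + c + d + e) < N)
    (hsum : a + b + c + d + e ≤ 3 * N)
    (hh : hodgeB6 N a b c d e (3 * N - (a + b + c + d + e)) = true) :
    restB6 N a b c d e = true := by
  unfold checkB6 at h
  rw [List.all_eq_true] at h
  have h1 := h a (List.mem_range'_1.mpr ⟨ha0, ha1⟩)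
  rw [List.all_eq_true] at h1
  have h2 := h1 b (List.mem_range'_1.mpr ⟨hab, by omega⟩)
  rw [List.all_eq_true] at h2
  have h3 := h2 c (List.mem_range'_1.mpr ⟨hbc, by omega⟩)
  rw [List.all_eq_true] at h3
  have h4 := h3 d (List.mem_range'_1.mpr ⟨hcd, by omega⟩)
  rw [List.all_eq_true] at h4
  have hlo : eLo N (a + b + c + d) d ≤ e := by unfold eLo; omega
  have hhi : e ≤ eHi N (a + b + c + d) := by unfold eHi; omega
  have h5 := h4 e (List.mem_range'_1.mpr ⟨hlo, by omega⟩)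
  simpa [hh] using h5

/-- **Soundness of the search (sorted form).** Chunks of first representatives covering `[1, N)` that all pass `checkB6` give
the conclusion of `(P⁴_N)` for every Hodge `6`-multiset listed by increasing representatives. [cite: Shioda1979PJA, §1 condition (Pⁿₘ), n = 4] -/
theorem p4Sorted_of_chunks (N : ℕ) [NeZero N] (chunks : List (ℕ × ℕ))
    (hcov : ∀ a, 0 < a → a < N → ∃ p ∈ chunks, p.1 ≤ a ∧ a < p.1 + p.2)
    (hs : ∀ p ∈ chunks, checkB6 N p.1 p.2 = true)
    (a b c d e : ZMod N) (hab : a.val ≤ b.val) (hbc : b.val ≤ c.val) (hcd : c.val ≤ d.val) (hde : d.val ≤ e.val)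
    (hef : e.val ≤ (-(a + b + c + d + e)).val) (hH : IsHodgeMultiset ({a, b, c, d, e, -(a + b + c + d + e)} : Multiset (ZMod N))) :
    IsDecomposable ({a, b, c, d, e, -(a + b + c + d + e)} : Multiset (ZMod N)) ∨
      IsQuasiDecomposable ({a, b, c, d, e, -(a + b + c + d + e)} : Multiset (ZMod N)) ∨
        IsSemiDecomposable ({a, b, c, d, e, -(a + b + c + d + e)} : Multiset (ZMod N)) := by
  have ha := ZMod.val_lt a
  have hb := ZMod.val_lt b
  have hc := ZMod.val_lt c
  have hd := ZMod.val_lt d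
  have hflt := ZMod.val_lt (-(a + b + c + d + e))
  have hsum := sum_val_eq_of_isHodgeMultiset_six hH
  have hfv : (-(a + b + c + d + e)).val = 3 * N - (a.val + b.val + c.val + d.val + e.val) := by omega
  have hh := hodgeB6_of_isHodgeMultiset hH
  rw [hfv] at hh hef hflt
  have ha0 : a ≠ 0 := hH.1.1 a (by simp)
  have hapos : 0 < a.val := by
    rcases Nat.eq_zero_or_pos a.val with h0 | h0
    · exact absurd ((ZMod.val_eq_zero a).mp h0) ha0
    · exact h0
  obtain ⟨p, hp, hp0, hp1⟩ := hcov a.val hapos ha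
  have h6 : card ({a, b, c, d, e, -(a + b + c + d + e)} : Multiset (ZMod N)) = 6 := by simp
  have hr := restB6_of_checkB6 (hs p hp) hp0 hp1 hab hb hbc hc hcd hd hde hef hflt (by omega) hh
  unfold restB6 at hr
  rw [sext_val] at hr
  simp only [Bool.or_eq_true, decide_eq_true_eq] at hr
  rcases hr with (hP | hS) | hQ
  · exact Or.inl (isDecomposable_of_hasPair hH h6 hP)
  · exact Or.inr (Or.inr (isSemiDecomposable_of_semiB h6 hS))
  · exact Or.inr (Or.inl (isQuasiDecomposable_of_quasiB h6 hQ))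

/-- **Soundness of the search, invariant form**: chunks of first representatives covering `[1, N)` that all pass `checkB6` give
`(P⁴_N)` = `ShiodaConditionUpTo N 4`. (Sort the representatives of a Hodge `6`-multiset; the largest is `−(sum of the others)` by
`Σ = 0`; apply the sorted form.) [cite: Shioda1979PJA, §1 condition (Pⁿₘ), n = 4] -/
theorem shiodaConditionUpTo_four_of_chunks (N : ℕ) [NeZero N] (chunks : List (ℕ × ℕ))
    (hcov : ∀ a, 0 < a → a < N → ∃ p ∈ chunks, p.1 ≤ a ∧ a < p.1 + p.2)
    (hchk : ∀ p ∈ chunks, checkB6 N p.1 p.2 = true) : ShiodaConditionUpTo N 4 := by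
  intro s hH h6 h6'
  have hcard : card s = 6 := by omega
  obtain ⟨v, hvs, hsorted⟩ : ∃ v : List ℕ, (v : Multiset ℕ) = s.map ZMod.val ∧ v.Pairwise (· ≤ ·) :=
    ⟨(s.map ZMod.val).sort, Multiset.sort_eq _ _, Multiset.pairwise_sort _ _⟩
  have hlen : v.length = 6 := by
    have := congrArg Multiset.card hvs
    simpa [hcard] using this
  obtain ⟨a', v1, rfl⟩ := List.exists_of_length_succ v hlen
  obtain ⟨b', v2, rfl⟩ := List.exists_of_length_succ v1 (by simpa using hlen)
  obtain ⟨c', v3, rfl⟩ := List.exists_of_length_succ v2 (by simpa using hlen)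
  obtain ⟨d', v4, rfl⟩ := List.exists_of_length_succ v3 (by simpa using hlen)
  obtain ⟨e', v5, rfl⟩ := List.exists_of_length_succ v4 (by simpa using hlen)
  obtain ⟨f', v6, rfl⟩ := List.exists_of_length_succ v5 (by simpa using hlen)
  have hv6 : v6 = [] := by simpa using hlen
  subst hv6
  have hlt : ∀ x ∈ ([a', b', c', d', e', f'] : List ℕ), x < N := by
    intro x hx
    have hx' : x ∈ s.map ZMod.val := by rw [← hvs]; exact Multiset.mem_coe.mpr hx
    obtain ⟨y, -, rfl⟩ := Multiset.mem_map.mp hx'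
    exact ZMod.val_lt y
  have ha' : a' < N := hlt a' (by simp)
  have hb' : b' < N := hlt b' (by simp)
  have hc' : c' < N := hlt c' (by simp)
  have hd' : d' < N := hlt d' (by simp)
  have he' : e' < N := hlt e' (by simp)
  have hf' : f' < N := hlt f' (by simp)
  have hs' : s = {(a' : ZMod N), (b' : ZMod N), (c' : ZMod N), (d' : ZMod N), (e' : ZMod N), (f' : ZMod N)} := by
    have h1 : s = (s.map ZMod.val).map (fun n : ℕ ↦ (n : ZMod N)) := by
      rw [Multiset.map_map]
      conv_lhs => rw [← Multiset.map_id s]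
      refine Multiset.map_congr rfl fun x _ ↦ ?_
      simp
    rw [h1, ← hvs]
    rfl
  have hsum : (f' : ZMod N) = -((a' : ZMod N) + (b' : ZMod N) + (c' : ZMod N) + (d' : ZMod N) + (e' : ZMod N)) := by
    have h0 := hH.1.2
    rw [hs'] at h0
    simp only [Multiset.insert_eq_cons, Multiset.sum_cons, Multiset.sum_singleton] at h0
    linear_combination h0
  rw [hs', hsum] at hH ⊢
  simp only [List.pairwise_cons, List.mem_cons, List.not_mem_nil, or_false, forall_eq_or_imp,
    forall_eq] at hsorted
  have hab : (a' : ZMod N).val ≤ (b' : ZMod N).val := by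
    rw [ZMod.val_natCast_of_lt ha', ZMod.val_natCast_of_lt hb']; omega
  have hbc : (b' : ZMod N).val ≤ (c' : ZMod N).val := by
    rw [ZMod.val_natCast_of_lt hb', ZMod.val_natCast_of_lt hc']; omega
  have hcd : (c' : ZMod N).val ≤ (d' : ZMod N).val := by
    rw [ZMod.val_natCast_of_lt hc', ZMod.val_natCast_of_lt hd']; omega
  have hde : (d' : ZMod N).val ≤ (e' : ZMod N).val := by
    rw [ZMod.val_natCast_of_lt hd', ZMod.val_natCast_of_lt he']; omega
  have hef : (e' : ZMod N).val ≤ (-((a' : ZMod N) + (b' : ZMod N) + (c' : ZMod N) + (d' : ZMod N) + (e' : ZMod N))).val := by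
    rw [← hsum, ZMod.val_natCast_of_lt he', ZMod.val_natCast_of_lt hf']; omega
  exact p4Sorted_of_chunks N chunks hcov hchk _ _ _ _ _ hab hbc hcd hde hef hH

/-! ### `(P⁴₃₉)` -/

set_option maxHeartbeats 0 in
/-- The search at `N = 39`, first representatives `a ∈ [1, 5)` (38 338 tuples). Kernel. [folklore] -/
theorem checkB6_39_1 : checkB6 39 1 4 = true := by decide +kernel

set_option maxHeartbeats 0 in
/-- The search at `N = 39`, first representatives `a ∈ [5, 10)` (32 803 tuples). Kernel. [folklore] -/
theorem checkB6_39_5 : checkB6 39 5 5 = true := by decide +kernel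

set_option maxHeartbeats 0 in
/-- The search at `N = 39`, first representatives `a ∈ [10, 39)` (11 895 tuples). Kernel. [folklore] -/
theorem checkB6_39_10 : checkB6 39 10 29 = true := by decide +kernel

/-- **`(P⁴₃₉)` holds**: every Hodge `6`-multiset over `ℤ/39` (every element of `M₃₉` of length `3`, i.e. every Hodge character of
the Fermat fourfold `X⁴₃₉` up to permutation) is decomposable, quasi-decomposable or semi-decomposable. With Shioda's Theorem 1
(PJA §2; tree spine `IsShiodaClosed.of_shiodaConditionUpTo`) this is the arithmetic half of "the Hodge conjecture holds for `X⁴₃₉`",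
a degree covered by no refereed theorem (public priority: the census of the preprint [Jumagulov2026OddFermatFourfolds,
Thm 1.5 / App. C]; this certificate is independent); the Math. Ann. form of `(P)` fails at `39` (`Shioda1979.not_conditionP_thirtynine_four`).
Certified by the cell's enumeration (P4-TABLE, two implementations + referee) and here by the kernel.
[cite: Shioda1979PJA, §1 condition (Pⁿₘ) and §2 Thm 1] -/
theorem shiodaConditionUpTo_thirtyNine_four : ShiodaConditionUpTo 39 4 :=
  shiodaConditionUpTo_four_of_chunks 39 [(1, 4), (5, 5), (10, 29)]
    (by
      intro a ha0 ha
      rcases Nat.lt_or_ge a 5 with h | h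
      · exact ⟨(1, 4), by simp, by omega, by omega⟩
      rcases Nat.lt_or_ge a 10 with h' | h'
      · exact ⟨(5, 5), by simp, h, by omega⟩
      · exact ⟨(10, 29), by simp, h', by omega⟩)
    (by
      intro p hp
      simp only [List.mem_cons, List.not_mem_nil, or_false] at hp
      rcases hp with rfl | rfl | rfl
      · exact checkB6_39_1
      · exact checkB6_39_5
      · exact checkB6_39_10)

/-- Consequence in the tree's currency: every Shioda-closed family of cycle characters mod `39` (pairs, surface classes, semi /
star / hash closure — the printed inductive structure) contains every Hodge character of `X⁴₃₉`. [cite: Shioda1979PJA, §2 Thm 1 and §4] -/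
theorem forall_of_isShiodaClosed_thirtyNine {C : Multiset (ZMod 39) → Prop} (hC : IsShiodaClosed C)
    (s : Multiset (ZMod 39)) (hs : IsHodgeMultiset s) (h0 : s ≠ 0) (h6 : card s ≤ 6) : C s :=
  hC.of_shiodaConditionUpTo shiodaConditionUpTo_thirtyNine_four s h0 hs h6

end Summit.HodgeConjecture.FermatCycles.ShiodaConditionFourfold
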